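import Summits.Ventures.LatticeQCDFlow.TrivializingMaps.WilsonVarianceExtensive
import Summits.Ventures.LatticeQCDFlow.TrivializingMaps.FisherZeroRadiusSharp

/-!
HONEST FRAMING: exact (Metropolis-corrected) sampling algorithms for lattice gauge theory; figures
of merit are autocorrelation/cost numbers at stated couplings and volumes; no continuum-physics
claim.

# PlaquetteDecorrelation — AT β = 0 A CLASS FUNCTION OF ONE PLAQUETTE IS UNCORRELATED WITH EVERY
# FUNCTION OF ANOTHER, FOR EVERY COMPACT GAUGE GROUP; `Var_{D[U]}(S_W) = #plaq · Var_Haar(Re tr ρ)`;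
# A FISHER ZERO WITHIN `4N / Var_Haar(Re tr ρ)` IN EVERY VOLUME (lean-2 GEN-8, ours)

Venture-side (OURS).  Cell `lqcd-flow` (pub-lqcd), unit `pub-lqcd-lean-2-g8`, 2026-08-22.  Sequel
of `WilsonVarianceExtensive` (there: `SU(n)` only, by left invariance under the CENTRE of `SU(n)`);
here the group is an arbitrary compact (second-countable) `G` and the mechanism is the Haar law of
one plaquette holonomy CONDITIONALLY on every other link (left invariance of `D[U]` at a fresh link,
Fubini over `Haar(G) ⊗ D[U]`, right invariance of Haar — the route of `PlaquetteHaarMoments`).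

* §1 lattice bookkeeping (`L ≥ 2`): for two different plaquettes `p = (x,i,j) ≠ p'` the tree's
  `exists_forward_link_fresh` gives a forward link `e` of `p` outside `p'`; if `e = (x, i)` then
  left-multiplying `U_e` by `h` multiplies `U_p` by `h` on the left; if `e = (x+î, j)` the same holds
  for the holonomy RE-BASED at `x + î`, which is conjugate to `U_p` (`exists_fresh_link_conjugate`).
* §2 **`integral_classFun_mul_eq_of_fresh`** / **`integral_classFun_plaquette_mul_eq`** — for every
  continuous CLASS function `φ` (`φ(aba⁻¹) = φ(b)`), every continuous `ψ`, `p ≠ p'`, `L ≥ 2`: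
  `∫ D[U] φ(U_p) ψ(U_{p'}) = (∫_G φ dHaar) · ∫ D[U] ψ(U_{p'})`; and
  `integral_comp_plaquetteHolonomy_eq_haar_group`: `∫ D[U] φ(U_p) = ∫_G φ dHaar` (any continuous `φ`).
* §3 **`variance_sum_classFun_plaquette_eq`** — `Var_{D[U]}(∑_p φ(U_p)) = #plaq · Var_Haar(φ)`;
  **`variance_wilsonAction_eq_card_mul`** — for every continuous matrix representation `ρ`:
  `Var_{D[U]}(S_W^ρ) = #plaquettes · Var_Haar(Re tr ρ)`, every `d`, every `L ≥ 2`.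
* §4 **`wilsonZ_exists_zero_norm_le_uniform`** — if `v_ρ := Var_Haar(Re tr ρ) > 0` then for every
  `d ≥ 2` and EVERY `L ≥ 2` the partition function `Z_L(s) = ∫ D[U] e^{-sS_W^ρ}` has a zero with
  `|s₀| ≤ 4N / v_ρ` — a VOLUME-INDEPENDENT disc for every compact gauge group and representation
  (`FisherZeroRadiusSharp.wilsonAction_exists_fisherZero_norm_le` with §3).
* `U(1)` (`Var_Haar(Re z) = ½`, a Fisher zero with `|s₀| ≤ 8` in every volume): the sequel
  `U1WilsonFisherZero`.

NOT CLAIMED: `L = 1`; `β ≠ 0`; the values `Var_Haar(Re tr ρ)` (`U(1)`: the sequel; `SU(n)`: the tree);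
sharpness of `4N/v_ρ`; cost / autocorrelation / continuum statements.  Literature grade (cell rule):
known mechanism (independence of plaquette variables sharing no fresh link under product Haar measure is
folklore of the strong-coupling expansion, e.g. [OsterwalderSeilerAnnPhys1978] §3); the volume-uniform
Fisher-zero disc for a general compact group is new typing, no new theorem of physics.
-/

open MeasureTheory ProbabilityTheory Filter Topology Complex Set Metric
open Literature.MathematicalPhysics.QuantumFieldTheory
open Literature.MathematicalPhysics.QuantumFieldTheory.Luscher2010

namespace Summit.Ventures.LatticeQCDFlow.TrivializingMaps

/-! ## §1 Lattice bookkeeping: a fresh link moves one plaquette by a conjugate of left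
multiplication and fixes the other -/

section Lattice

variable {d L : ℕ} [NeZero L] {G : Type*} [Group G]

omit [NeZero L] in
/-- The holonomy of `(x,i,j)` is conjugate (by `U(x,i)`) to the holonomy re-based at `x + î`:
`U_p = U(x,i) · [U(x+î,j) U(x+ĵ,i)⁻¹ U(x,j)⁻¹ U(x,i)] · U(x,i)⁻¹`. [folklore] -/
theorem plaquetteHolonomy_eq_conj_rebased (U : GaugeConfig d L G) (x : Site d L) (i j : Fin d) :
    plaquetteHolonomy U x i j =
      U (x, i) * (U (x.shift i, j) * (U (x.shift j, i))⁻¹ * (U (x, j))⁻¹ * U (x, i)) * (U (x, i))⁻¹ := by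
  simp only [plaquetteHolonomy, mul_assoc, mul_inv_cancel, mul_one]

/-- Left-multiplying the second forward link `(x+î, j)` multiplies the RE-BASED holonomy by `h` on the
left (`i ≠ j`, `L ≥ 2`). [folklore] -/
theorem rebased_mulSingle_second [DecidableEq (Edge d L)] (hL : 2 ≤ L) (U : GaugeConfig d L G)
    (x : Site d L) {i j : Fin d} (hij : i ≠ j) (h : G) :
    (fun V : GaugeConfig d L G => V (x.shift i, j) * (V (x.shift j, i))⁻¹ * (V (x, j))⁻¹ * V (x, i))
        (Pi.mulSingle (x.shift i, j) h * U) =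
      h * (U (x.shift i, j) * (U (x.shift j, i))⁻¹ * (U (x, j))⁻¹ * U (x, i)) := by
  have h1 : ((x.shift j, i) : Edge d L) ≠ (x.shift i, j) := fun e => hij (congrArg Prod.snd e)
  have h2 : ((x, j) : Edge d L) ≠ (x.shift i, j) := fun e =>
    site_shift_ne_self_of_two_le hL x i (congrArg Prod.fst e).symm
  have h3 : ((x, i) : Edge d L) ≠ (x.shift i, j) := fun e => hij (congrArg Prod.snd e)
  simp only [Pi.mul_apply, Pi.mulSingle_eq_same, Pi.mulSingle_eq_of_ne h1,
    Pi.mulSingle_eq_of_ne h2, Pi.mulSingle_eq_of_ne h3, one_mul, mul_assoc]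

variable [TopologicalSpace G] [IsTopologicalGroup G]

/-- **For two different plaquettes `p = (x,i,j) ≠ p' = (x',i',j')` (`L ≥ 2`) there are a link `e`, a
continuous `W : (E → G) → G` and `c : (E → G) → G` with `U_p = c(U) W(U) c(U)⁻¹`,
`W(h ·_e U) = h W(U)` and `U_{p'}(h ·_e U) = U_{p'}`** (`h ·_e U` = left multiplication of the link
`e` by `h`). [ours] -/
theorem exists_fresh_link_conjugate [DecidableEq (Edge d L)] (hL : 2 ≤ L) {x x' : Site d L}
    {i j i' j' : Fin d} (hij : i < j) (hij' : i' < j') (hne : ¬ (x = x' ∧ i = i' ∧ j = j')) :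
    ∃ (e : Edge d L) (W c : GaugeConfig d L G → G), Continuous W ∧
      (∀ U, plaquetteHolonomy U x i j = c U * W U * (c U)⁻¹) ∧
      (∀ (h : G) (U : GaugeConfig d L G), W (Pi.mulSingle e h * U) = h * W U) ∧
      (∀ (h : G) (U : GaugeConfig d L G),
        plaquetteHolonomy (Pi.mulSingle e h * U) x' i' j' = plaquetteHolonomy U x' i' j') := by
  obtain ⟨e, he, h1, h2, h3, h4⟩ := exists_forward_link_fresh hL hij hij' hne
  have hfix : ∀ (h : G) (U : GaugeConfig d L G),
      plaquetteHolonomy (Pi.mulSingle e h * U) x' i' j' = plaquetteHolonomy U x' i' j' :=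
    fun h U => plaquetteHolonomy_mulSingle_of_ne U x' i' j' h1 h2 h3 h4 h
  rcases he with rfl | rfl
  · refine ⟨(x, i), fun U => plaquetteHolonomy U x i j, fun _ => 1, ?_, fun U => by simp,
      fun h U => plaquetteHolonomy_mulSingle_left hL U x (ne_of_lt hij) h, hfix⟩
    unfold plaquetteHolonomy; fun_prop
  · refine ⟨(x.shift i, j),
      fun U => U (x.shift i, j) * (U (x.shift j, i))⁻¹ * (U (x, j))⁻¹ * U (x, i),
      fun U => U (x, i), by fun_prop, fun U => plaquetteHolonomy_eq_conj_rebased U x i j,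
      fun h U => rebased_mulSingle_second hL U x (ne_of_lt hij) h, hfix⟩

end Lattice

/-! ## §2 Decorrelation by left invariance at a fresh link, Fubini, right invariance of Haar -/

section Decorrelation

variable {d L : ℕ} [NeZero L] {G : Type*} [Group G] [TopologicalSpace G] [IsTopologicalGroup G]
  [CompactSpace G] [MeasurableSpace G] [BorelSpace G] [SecondCountableTopology G]

/-- Continuous functions on the compact configuration space `G^E` are `D[U]`-integrable. [folklore] -/
theorem integrable_trivialMeasure_of_continuous_group {f : GaugeConfig d L G → ℝ}
    (hf : Continuous f) : Integrable f (trivialMeasure G d L) := by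
  haveI : IsProbabilityMeasure (trivialMeasure G d L) := by unfold trivialMeasure; infer_instance
  exact (BoundedContinuousFunction.mkOfCompact ⟨f, hf⟩).integrable _

/-- **The abstract decorrelation step.**  If `W : G^E → G` is continuous and covariant under left
multiplication of the link `e` (`W(h ·_e U) = h W(U)`) and `F : G^E → ℝ` is continuous and invariant
under it, then for every continuous `φ : G → ℝ`:
`∫ D[U] φ(W U) F(U) = (∫_G φ dHaar) · ∫ D[U] F` (left invariance of `D[U]`, Fubini over
`Haar ⊗ D[U]`, right invariance of Haar on the compact group). [ours] -/
theorem integral_classFun_mul_eq_of_fresh [DecidableEq (Edge d L)] (e : Edge d L)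
    {W : GaugeConfig d L G → G} (hWc : Continuous W)
    (hW : ∀ (h : G) (U : GaugeConfig d L G), W (Pi.mulSingle e h * U) = h * W U)
    {F : GaugeConfig d L G → ℝ} (hFc : Continuous F)
    (hF : ∀ (h : G) (U : GaugeConfig d L G), F (Pi.mulSingle e h * U) = F U)
    {φ : G → ℝ} (hφ : Continuous φ) :
    ∫ U, φ (W U) * F U ∂(trivialMeasure G d L) =
      (∫ g, φ g ∂(haarProbability G)) * ∫ U, F U ∂(trivialMeasure G d L) := by
  set D := trivialMeasure G d L with hD
  set μ := haarProbability G with hμ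
  haveI : D.IsMulLeftInvariant := by rw [hD]; unfold trivialMeasure; infer_instance
  haveI : IsProbabilityMeasure D := by rw [hD]; unfold trivialMeasure; infer_instance
  -- (1) left invariance at the link `e`
  have hinv : ∀ h : G, ∫ U, φ (h * W U) * F U ∂D = ∫ U, φ (W U) * F U ∂D := by
    intro h
    have key := integral_mul_left_eq_self (μ := D) (fun U => φ (W U) * F U) (Pi.mulSingle e h)
    have hfun : (fun U : GaugeConfig d L G => φ (W (Pi.mulSingle e h * U)) * F (Pi.mulSingle e h * U))
        = fun U => φ (h * W U) * F U := funext fun U => by rw [hW h U, hF h U]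
    rw [hfun] at key
    exact key
  -- (2) Fubini over `Haar ⊗ D[U]`, right invariance of Haar
  have hcont : Continuous fun q : G × GaugeConfig d L G => φ (q.1 * W q.2) * F q.2 :=
    (hφ.comp (continuous_fst.mul (hWc.comp continuous_snd))).mul (hFc.comp continuous_snd)
  have hint : Integrable (Function.uncurry fun (h : G) (U : GaugeConfig d L G) =>
      φ (h * W U) * F U) (μ.prod D) :=
    (BoundedContinuousFunction.mkOfCompact ⟨_, hcont⟩).integrable _
  calc ∫ U, φ (W U) * F U ∂D
      = ∫ h, ∫ U, φ (W U) * F U ∂D ∂μ := by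
        rw [integral_const, smul_eq_mul, probReal_univ, one_mul]
    _ = ∫ h, ∫ U, φ (h * W U) * F U ∂D ∂μ :=
        integral_congr_ae (ae_of_all _ fun h => (hinv h).symm)
    _ = ∫ U, ∫ h, φ (h * W U) * F U ∂μ ∂D := integral_integral_swap hint
    _ = ∫ U, (∫ g, φ g ∂μ) * F U ∂D := by
        refine integral_congr_ae (ae_of_all _ fun U => ?_)
        simp only
        rw [integral_mul_const, integral_mul_right_eq_self (μ := μ) φ (W U)]
    _ = (∫ g, φ g ∂μ) * ∫ U, F U ∂D := integral_const_mul _ _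

/-- **`∫ D[U] φ(U_p) = ∫_G φ dHaar`** for every compact (second-countable) gauge group, every
continuous `φ`, every plaquette `(x,i,j)` (`i ≠ j`) and every `L ≥ 2` (the tree's
`integral_comp_plaquetteHolonomy_eq_haar` for `SU(n)`, same proof). [folklore] -/
theorem integral_comp_plaquetteHolonomy_eq_haar_group (hL : 2 ≤ L) (x : Site d L) {i j : Fin d}
    (hij : i ≠ j) {φ : G → ℝ} (hφ : Continuous φ) :
    ∫ U, φ (plaquetteHolonomy U x i j) ∂(trivialMeasure G d L) = ∫ g, φ g ∂(haarProbability G) := by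
  classical
  haveI : IsProbabilityMeasure (trivialMeasure G d L) := by unfold trivialMeasure; infer_instance
  have hhol : Continuous fun U : GaugeConfig d L G => plaquetteHolonomy U x i j := by
    unfold plaquetteHolonomy; fun_prop
  have h := integral_classFun_mul_eq_of_fresh (d := d) (L := L) (x, i) hhol
    (fun h U => plaquetteHolonomy_mulSingle_left hL U x hij h) (F := fun _ => (1 : ℝ))
    continuous_const (fun _ _ => rfl) hφ
  simpa using h

/-- **AT β = 0 A CLASS FUNCTION OF ONE PLAQUETTE IS UNCORRELATED WITH EVERY FUNCTION OF ANOTHER.**  For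
`G` compact (second countable), `p ≠ p'`, `L ≥ 2`, `φ` a continuous class function and `ψ`
continuous: `∫ D[U] φ(U_p) ψ(U_{p'}) = (∫_G φ dHaar) · ∫ D[U] ψ(U_{p'})`. [ours] -/
theorem integral_classFun_plaquette_mul_eq (hL : 2 ≤ L) {p p' : Plaquette d L} (hpp' : p ≠ p')
    {φ : G → ℝ} (hφ : Continuous φ) (hclass : ∀ a b : G, φ (a * b * a⁻¹) = φ b)
    {ψ : G → ℝ} (hψ : Continuous ψ) :
    ∫ U, φ (plaquetteHolonomy U p.1 p.2.1.1 p.2.1.2) * ψ (plaquetteHolonomy U p'.1 p'.2.1.1 p'.2.1.2)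
        ∂(trivialMeasure G d L) =
      (∫ g, φ g ∂(haarProbability G)) *
        ∫ U, ψ (plaquetteHolonomy U p'.1 p'.2.1.1 p'.2.1.2) ∂(trivialMeasure G d L) := by
  classical
  obtain ⟨x, ⟨⟨i, j⟩, hij⟩⟩ := p
  obtain ⟨x', ⟨⟨i', j'⟩, hij'⟩⟩ := p'
  simp only at hij hij' ⊢
  have hne : ¬ (x = x' ∧ i = i' ∧ j = j') := by
    rintro ⟨rfl, rfl, rfl⟩; exact hpp' rfl
  obtain ⟨e, W, c, hWc, hconj, hW, hfix⟩ :=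
    exists_fresh_link_conjugate (G := G) hL hij hij' hne
  have hφW : ∀ U : GaugeConfig d L G, φ (plaquetteHolonomy U x i j) = φ (W U) := fun U => by
    rw [hconj U, hclass]
  have hhol' : Continuous fun U : GaugeConfig d L G => plaquetteHolonomy U x' i' j' := by
    unfold plaquetteHolonomy; fun_prop
  simp_rw [hφW]
  exact integral_classFun_mul_eq_of_fresh e hWc hW (hψ.comp hhol') (fun h U => by
    simp only [Function.comp_apply, hfix h U]) hφ

end Decorrelation

/-! ## §3 The β = 0 variance of a sum of plaquette class functions; the Wilson action -/

section Variance

variable {d L : ℕ} [NeZero L] {G : Type*} [Group G] [TopologicalSpace G] [IsTopologicalGroup G]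
  [CompactSpace G] [MeasurableSpace G] [BorelSpace G] [SecondCountableTopology G]

/-- **`Var_{D[U]}(∑_p φ(U_p)) = #plaquettes · Var_Haar(φ)`** for every continuous class function `φ`
on a compact (second-countable) group, every `d` and every `L ≥ 2`. [ours] -/
theorem variance_sum_classFun_plaquette_eq (hL : 2 ≤ L) {φ : G → ℝ} (hφ : Continuous φ)
    (hclass : ∀ a b : G, φ (a * b * a⁻¹) = φ b) :
    variance (fun U : GaugeConfig d L G => ∑ p : Plaquette d L,
        φ (plaquetteHolonomy U p.1 p.2.1.1 p.2.1.2)) (trivialMeasure G d L) =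
      Fintype.card (Plaquette d L) * variance φ (haarProbability G) := by
  set D := trivialMeasure G d L with hD
  set μ := haarProbability G with hμ
  haveI : IsProbabilityMeasure D := by rw [hD]; unfold trivialMeasure; infer_instance
  obtain ⟨C, hC⟩ : ∃ C, ∀ g, ‖φ g‖ ≤ C :=
    ⟨_, (BoundedContinuousFunction.mkOfCompact ⟨φ, hφ⟩).norm_coe_le_norm⟩
  set Xp : Plaquette d L → GaugeConfig d L G → ℝ :=
    fun p U => φ (plaquetteHolonomy U p.1 p.2.1.1 p.2.1.2) with hXpdef
  have hXc : ∀ p, Continuous (Xp p) := fun p => by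
    simp only [hXpdef]
    refine hφ.comp ?_
    unfold plaquetteHolonomy; fun_prop
  have hXm : ∀ p, MemLp (Xp p) 2 D := fun p =>
    MemLp.of_bound (integrable_trivialMeasure_of_continuous_group (hXc p)).aestronglyMeasurable C
      (ae_of_all _ fun U => hC _)
  have hφm : MemLp φ 2 μ :=
    MemLp.of_bound hφ.aestronglyMeasurable C (ae_of_all _ fun g => hC g)
  have hmean : ∀ p : Plaquette d L, ∫ U, Xp p U ∂D = ∫ g, φ g ∂μ := fun p =>
    integral_comp_plaquetteHolonomy_eq_haar_group hL p.1 (ne_of_lt p.2.2) hφ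
  have hsq : ∀ p : Plaquette d L, ∫ U, Xp p U * Xp p U ∂D = ∫ g, φ g * φ g ∂μ := fun p =>
    integral_comp_plaquetteHolonomy_eq_haar_group hL p.1 (ne_of_lt p.2.2) (φ := fun g => φ g * φ g)
      (hφ.mul hφ)
  show variance (fun U => ∑ p, Xp p U) D = _
  rw [variance_fun_sum hXm]
  have hcov : ∀ p q : Plaquette d L, cov[Xp p, Xp q; D] = if p = q then variance φ μ else 0 := by
    intro p q
    rw [covariance_eq_sub (hXm p) (hXm q)]
    split_ifs with hpq
    · subst hpq
      rw [← covariance_self hφ.aemeasurable, covariance_eq_sub hφm hφm]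
      simp only [Pi.mul_apply, hsq p, hmean p]
    · simp only [Pi.mul_apply]
      rw [integral_classFun_plaquette_mul_eq hL hpq hφ hclass hφ, hmean p, hmean q, sub_self]
  simp only [hcov, Finset.sum_ite_eq, Finset.mem_univ, if_true, Finset.sum_const, Finset.card_univ,
    nsmul_eq_mul]

variable {N : ℕ} (ρ : G →* Matrix (Fin N) (Fin N) ℂ)

/-- **`Var_{D[U]}(S_W^ρ) = #plaquettes · Var_Haar(Re tr ρ)`** for every compact (second-countable)
gauge group, every continuous matrix representation `ρ`, every `d` and every `L ≥ 2`. [ours] -/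
theorem variance_wilsonAction_eq_card_mul (hρ : Continuous ρ) (hL : 2 ≤ L) :
    variance (wilsonAction (d := d) (L := L) ρ) (trivialMeasure G d L) =
      Fintype.card (Plaquette d L) * variance (fun g => (ρ g).trace.re) (haarProbability G) := by
  have hre : Continuous fun g : G => (ρ g).trace.re :=
    Complex.continuous_re.comp (Continuous.matrix_trace hρ)
  have hφc : Continuous fun g : G => (N : ℝ) - (ρ g).trace.re := continuous_const.sub hre
  -- `Re tr ρ` is a class function (cyclicity of the trace; cf. the tree's `re_trace_map_conj`)
  have hclass : ∀ a b : G, (N : ℝ) - (ρ (a * b * a⁻¹)).trace.re = (N : ℝ) - (ρ b).trace.re :=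
    fun a b => by
      rw [map_mul, map_mul, Matrix.trace_mul_cycle, ← map_mul, inv_mul_cancel, map_one, one_mul]
  have key := variance_sum_classFun_plaquette_eq (d := d) (L := L) hL hφc hclass
  have hvar : variance (fun g : G => (N : ℝ) - (ρ g).trace.re) (haarProbability G) =
      variance (fun g : G => (ρ g).trace.re) (haarProbability G) := by
    have h1 : (fun g : G => (N : ℝ) - (ρ g).trace.re) = fun g => -(ρ g).trace.re + N := by
      funext g; ring
    have hneg : Continuous fun g : G => -(ρ g).trace.re := hre.neg
    rw [h1, variance_add_const hneg.aestronglyMeasurable, variance_fun_neg]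
  rw [hvar] at key
  exact key

end Variance

/-! ## §4 A Fisher zero in one volume-independent disc, every compact gauge group -/

section Uniform

variable {d L N : ℕ} [NeZero L] {G : Type*} [Group G] [TopologicalSpace G] [IsTopologicalGroup G]
  [CompactSpace G] [MeasurableSpace G] [BorelSpace G] [SecondCountableTopology G]
  (ρ : G →* Matrix (Fin N) (Fin N) ℂ)

/-- **VOLUME-INDEPENDENT FISHER-ZERO DISC FOR EVERY COMPACT GAUGE GROUP.**  If
`v_ρ := Var_Haar(Re tr ρ) > 0` then for every `d ≥ 2` and EVERY `L ≥ 2` the partition function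
`Z_L(s) = ∫ D[U] e^{-sS_W^ρ}` has a zero `s₀` with `|s₀| ≤ 4N / v_ρ`. [ours] -/
theorem wilsonZ_exists_zero_norm_le_uniform (hρ : Continuous ρ) (hd : 2 ≤ d) (hL : 2 ≤ L)
    (hv : 0 < variance (fun g => (ρ g).trace.re) (haarProbability G)) :
    ∃ s₀ : ℂ, ‖s₀‖ ≤ 4 * N / variance (fun g => (ρ g).trace.re) (haarProbability G) ∧
      complexMGF (fun U => -wilsonAction ρ U) (trivialMeasure G d L) s₀ = 0 := by
  set v := variance (fun g => (ρ g).trace.re) (haarProbability G) with hv'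
  set P : ℝ := (Fintype.card (Plaquette d L) : ℝ) with hPdef
  have hP : 1 ≤ P := by rw [hPdef]; exact_mod_cast WilsonPinching.one_le_card_plaquette hd
  have hP0 : 0 < P := by linarith
  have hvar : variance (wilsonAction ρ) (trivialMeasure G d L) = P * v :=
    variance_wilsonAction_eq_card_mul ρ hρ hL
  have hvarpos : 0 < variance (wilsonAction ρ) (trivialMeasure G d L) := by
    rw [hvar]; positivity
  obtain ⟨s₀, hs₀, hz⟩ := wilsonAction_exists_fisherZero_norm_le (d := d) (L := L) ρ hρ hvarpos
  refine ⟨s₀, ?_, hz⟩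
  rw [hvar, ← hPdef] at hs₀
  calc ‖s₀‖ ≤ 4 * (N * P) / (P * v) := hs₀
    _ = 4 * N / v := by field_simp

/-- Lüscher's notation: a zero of `s ↦ ∫ D[U] e^{-sS_W}` with `|s₀| ≤ 4N / v_ρ`, every `L ≥ 2`. [ours] -/
theorem wilsonZ_integral_exists_zero_norm_le_uniform (hρ : Continuous ρ) (hd : 2 ≤ d) (hL : 2 ≤ L)
    (hv : 0 < variance (fun g => (ρ g).trace.re) (haarProbability G)) :
    ∃ s₀ : ℂ, ‖s₀‖ ≤ 4 * N / variance (fun g => (ρ g).trace.re) (haarProbability G) ∧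
      ∫ U, cexp (-(s₀ * (wilsonAction ρ U : ℂ))) ∂(trivialMeasure G d L) = 0 := by
  obtain ⟨s₀, hs₀, hz⟩ := wilsonZ_exists_zero_norm_le_uniform (d := d) (L := L) ρ hρ hd hL hv
  exact ⟨s₀, hs₀, by rw [← WilsonPinching.complexMGF_neg_wilsonAction ρ s₀]; exact hz⟩

end Uniform

end Summit.Ventures.LatticeQCDFlow.TrivializingMaps
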